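import Summits.PneNP.PneNP.Theorems.ReslinSizeFromWidthQuadraticPrune

/-!
# PneNP / ReslinSizeFromWidth — quadratic size–width law, part 3b: the restriction lemma for width

Helper file for the quadratic truncation of crux `ResLinSizeFromWidth` (stmt-PneNP-18932).
GLUING: if an equation `θ` cuts the ambient flat `A` into nonempty halves `H0 = A ∩ hyp θ`,
`H1 = A ∩ hyp (θ+1)`, then a semantic refutation inside `H1` of width `a` and one inside `H0` of
width `b` give one inside `A` of width `≤ max (a+1) (max b t)`: the `H1`-refutation is read inside
`A` (ranks `+1`), the `H0`-refutation is lifted query-free by cylinders in the direction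
`v = z₀ + z₁` joining the halves (ranks unchanged), each axiom step re-opened into a split between
the axiom flat and `H1`.  Contrapositively: if all refutations inside `A` have width `≥ K > t`,
then all refutations inside `H1` have width `≥ K-1` or all inside `H0` have width `≥ K` — the
Res(⊕) form of Ben-Sasson–Wigderson's `w(φ) ≤ max(w(φ|x=1)+1, w(φ|x=0))`.
-/

namespace Summit.PneNP.PneNP.Theorems

-- `Summit.PneNP.PneNP` repeats a path component by design (summit = sub-problem); silence the linter.
set_option linter.dupNamespace false

namespace ResLinSW

section Induction

open Module Submodule
open scoped Pointwise

variable {V : Type*} [Fintype V]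

/-! ### Gluing: the restriction lemma for width -/

section Glue

variable (𝒞 : Set (Set (V → ZMod 2))) (A H1 : Set (V → ZMod 2)) (v : V → ZMod 2)

open Classical in
/-- The line inserted below a lifted line: an axiom flat containing the original line (cut to
`A`) if there is one, else `H1`. -/
noncomputable def filler (N : Set (V → ZMod 2)) : Set (V → ZMod 2) :=
  if h : ∃ F ∈ 𝒞, N ⊆ F then Classical.choose h ∩ A else H1

/-- The query-free lift of a list of lines: each line becomes its cylinder, followed by its
filler. -/
noncomputable def liftAll : List (Set (V → ZMod 2)) → List (Set (V → ZMod 2))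
  | [] => []
  | N :: L => cyl v N :: filler 𝒞 A H1 N :: liftAll L

/-- Cylinders of members are members of the lift. -/
theorem cyl_mem_liftAll {N : Set (V → ZMod 2)} :
    ∀ {L : List (Set (V → ZMod 2))}, N ∈ L → cyl v N ∈ liftAll 𝒞 A H1 v L
  | [], h => absurd h List.not_mem_nil
  | M :: L, h => by
    simp only [liftAll, List.mem_cons]
    rcases List.mem_cons.1 h with rfl | h
    · exact Or.inl rfl
    · exact Or.inr (Or.inr (cyl_mem_liftAll h))

/-- Members of the lift are cylinders of members or fillers of members. -/
theorem mem_liftAll_iff (L : List (Set (V → ZMod 2))) (X : Set (V → ZMod 2)) :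
    X ∈ liftAll 𝒞 A H1 v L ↔ ∃ N ∈ L, X = cyl v N ∨ X = filler 𝒞 A H1 N := by
  induction L with
  | nil => simp [liftAll]
  | cons M L ih =>
    simp only [liftAll, List.mem_cons, ih]
    constructor
    · rintro (h | h | ⟨N, hN, h⟩)
      · exact ⟨M, Or.inl rfl, Or.inl h⟩
      · exact ⟨M, Or.inl rfl, Or.inr h⟩
      · exact ⟨N, Or.inr hN, h⟩
    · rintro ⟨N, rfl | hN, h⟩
      · rcases h with h | h
        · exact Or.inl h
        · exact Or.inr (Or.inl h)
      · exact Or.inr (Or.inr ⟨N, hN, h⟩)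

/-- The lift doubles the length. -/
theorem length_liftAll : ∀ L : List (Set (V → ZMod 2)), (liftAll 𝒞 A H1 v L).length = 2 * L.length
  | [] => rfl
  | M :: L => by simp [liftAll, length_liftAll L]; ring

end Glue

/-- **Gluing (restriction lemma for width).** Let `θ` cut the flat `A` into nonempty halves
`H0 = A ∩ hyp θ`, `H1 = A ∩ hyp (θ+1)`.  A refutation of `𝒞` inside `H1` of width `a` and one
inside `H0` of width `b` give a refutation inside `A` of width `≤ max (a+1) (max b t)`. -/
theorem glue {𝒞 : Set (Set (V → ZMod 2))} {A : Set (V → ZMod 2)} {t : ℕ} (hg : GoodAxioms 𝒞 A t)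
    (hA : IsFlat A) (θ : Eqn V) (h0ne : (A ∩ hyp θ).Nonempty) (h1ne : (A ∩ hyp (θ + one)).Nonempty)
    {R1 R0 : List (Set (V → ZMod 2))} (hR1 : IsRef 𝒞 (A ∩ hyp (θ + one)) R1)
    (hR0 : IsRef 𝒞 (A ∩ hyp θ) R0) :
    ∃ G, IsRef 𝒞 A G ∧
      width A G ≤ max (width (A ∩ hyp (θ + one)) R1 + 1) (max (width (A ∩ hyp θ) R0) t) := by
  classical
  set H0 := A ∩ hyp θ with hH0
  set H1 := A ∩ hyp (θ + one) with hH1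
  obtain ⟨z₀, hz₀A, hz₀⟩ := h0ne
  obtain ⟨z₁, hz₁A, hz₁⟩ := h1ne
  set v := z₀ + z₁ with hv
  -- the direction v joins the halves: θ sees it, the equations of A do not
  have hθv : θ.1 ⬝ᵥ v = 1 := by
    rw [hv, dotProduct_add, mem_hyp.1 hz₀]
    have h1' : (θ + one).1 ⬝ᵥ z₁ = (θ + one).2 := mem_hyp.1 hz₁
    simp only [one, Prod.fst_add, Prod.snd_add, add_zero] at h1'
    rw [h1']
    have h2 : ∀ a : ZMod 2, a + (a + 1) = 1 := by decide
    exact h2 θ.2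
  have hAv : ∀ ξ ∈ W A, ξ.1 ⬝ᵥ v = 0 := by
    intro ξ hξ
    rw [hv, dotProduct_add, hξ z₀ hz₀A, hξ z₁ hz₁A]
    have h2 : ∀ a : ZMod 2, a + a = 0 := by decide
    exact h2 ξ.2
  -- cylinders over subsets of H0 stay inside A
  have hcylA : ∀ N ⊆ H0, cyl v N ⊆ A := by
    intro N hN z hz
    rcases mem_cyl_iff.1 hz with h | h
    · exact (hN h).1
    · have hzv : z = (z + v) + z₀ + z₁ := by
        rw [add_assoc (z + v) z₀ z₁, ← hv, add_assoc z v v, add_self_eq_zero, add_zero]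
      rw [hzv]
      exact hA.add_add_mem (hN h).1 hz₀A hz₁A
  -- the lift of H0 is A
  have hcylH0 : cyl v H0 = A := by
    refine Set.Subset.antisymm (hcylA H0 Set.Subset.rfl) fun z hz => ?_
    rw [mem_cyl_iff]
    by_cases hzθ : z ∈ hyp θ
    · exact Or.inl ⟨hz, hzθ⟩
    · right
      refine ⟨?_, ?_⟩
      · have : z + v = z + z₀ + z₁ := by rw [hv, add_assoc]
        rw [this]
        exact hA.add_add_mem hz hz₀A hz₁A
      · rw [mem_hyp, dotProduct_add, hθv, (zmod2_ne_iff.1 hzθ)]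
        have h2 : ∀ a : ZMod 2, a + 1 + 1 = a := by decide
        exact h2 θ.2
  -- dimension bookkeeping
  have hWH0 : finrank (ZMod 2) ↥(W H0) = finrank (ZMod 2) ↥(W A) + 1 :=
    finrank_W_section hA ⟨z₀, hz₀A, hz₀⟩ ⟨z₁, hz₁A, hz₁⟩
  have hWH1 : finrank (ZMod 2) ↥(W H1) = finrank (ZMod 2) ↥(W A) + 1 := by
    refine finrank_W_section hA ⟨z₁, hz₁A, hz₁⟩ ?_
    rw [add_one_add_one]
    exact ⟨z₀, hz₀A, hz₀⟩
  have hcodim_cyl : ∀ N ⊆ H0, N.Nonempty → codim A (cyl v N) = codim H0 N := by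
    intro N hN hne
    have hθN : θ ∈ W N := fun z hz => (hN hz).2
    have h := finrank_W_cyl_add_one v hne hθN hθv
    have hmono : finrank (ZMod 2) ↥(W H0) ≤ finrank (ZMod 2) ↥(W N) :=
      Submodule.finrank_mono (W_anti hN)
    unfold codim
    omega
  have hcodim_H1 : ∀ N ⊆ H1, codim A N = codim H1 N + 1 ∨ finrank (ZMod 2) ↥(W N) < finrank (ZMod 2) ↥(W H1) := by
    intro N hN
    have hmono : finrank (ZMod 2) ↥(W H1) ≤ finrank (ZMod 2) ↥(W N) :=
      Submodule.finrank_mono (W_anti hN)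
    left
    unfold codim
    omega
  -- the glued list
  set G := liftAll 𝒞 A H1 v R0 ++ R1 with hG
  have hH1R1 : H1 ∈ R1 := hR1.root
  -- justification of a filler
  have hfill : ∀ (N : Set (V → ZMod 2)) (T : List (Set (V → ZMod 2))), H1 ∈ T →
      Justified 𝒞 T (filler 𝒞 A H1 N) := by
    intro N T hT
    unfold filler
    split_ifs with h
    · exact Justified.ax _ (Classical.choose_spec h).1 Set.inter_subset_left
    · exact Justified.weaken hT Set.Subset.rfl
  -- the twisted equation used to lift a split
  have htwist : ∀ (η : Eqn V), ∃ η' : Eqn V, η'.1 ⬝ᵥ v = 0 ∧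
      ∀ z ∈ hyp θ, (z ∈ hyp η' ↔ z ∈ hyp η) := by
    intro η
    refine ⟨η + (η.1 ⬝ᵥ v) • θ, ?_, ?_⟩
    · simp only [Prod.fst_add, Prod.smul_fst, add_dotProduct, smul_dotProduct, smul_eq_mul, hθv,
        mul_one]
      have h2 : ∀ a : ZMod 2, a + a = 0 := by decide
      exact h2 _
    · intro z hz
      rw [mem_hyp] at hz
      simp only [mem_hyp, Prod.fst_add, Prod.smul_fst, Prod.snd_add, Prod.smul_snd, add_dotProduct,
        smul_dotProduct, smul_eq_mul, hz]
      constructor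
      · intro h; exact add_right_cancel h
      · intro h; rw [h]
  -- lifting a split
  have hlift_half : ∀ (N : Set (V → ZMod 2)), N ⊆ H0 → ∀ (η η' : Eqn V), η'.1 ⬝ᵥ v = 0 →
      (∀ z ∈ hyp θ, (z ∈ hyp η' ↔ z ∈ hyp η)) →
      cyl v N ∩ hyp η' ⊆ cyl v (N ∩ hyp η) ∧
        cyl v N ∩ hyp (η' + one) ⊆ cyl v (N ∩ hyp (η + one)) := by
    intro N hN η η' hη'v hiff
    have key : ∀ z, z + v ∈ N → (z ∈ hyp η' ↔ z + v ∈ hyp η) := by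
      intro z hz
      have hzv : z + v ∈ hyp θ := (hN hz).2
      rw [← hiff _ hzv, mem_hyp, mem_hyp, dotProduct_add, hη'v, add_zero]
    constructor
    · rintro z ⟨hz, hzη⟩
      rcases mem_cyl_iff.1 hz with h | h
      · exact subset_cyl v _ ⟨h, (hiff z (hN h).2).1 hzη⟩
      · exact mem_cyl_iff.2 (Or.inr ⟨h, (key z h).1 hzη⟩)
    · rintro z ⟨hz, hzη⟩
      rw [mem_hyp_add_one_iff] at hzη
      rcases mem_cyl_iff.1 hz with h | h
      · exact subset_cyl v _ ⟨h, mem_hyp_add_one_iff.2 fun h' => hzη ((hiff z (hN h).2).2 h')⟩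
      · exact mem_cyl_iff.2 (Or.inr ⟨h, mem_hyp_add_one_iff.2 fun h' => hzη ((key z h).2 h')⟩)
  -- the derivation property of the glued list, by induction on R0
  have hderiv : ∀ L : List (Set (V → ZMod 2)), IsDeriv 𝒞 L → (∀ N ∈ L, N ⊆ H0) →
      IsDeriv 𝒞 (liftAll 𝒞 A H1 v L ++ R1) := by
    intro L
    induction L with
    | nil => intro _ _; simpa [liftAll] using hR1.deriv
    | cons N L ih =>
      intro hd hsub
      have hNH0 : N ⊆ H0 := hsub N (List.mem_cons_self)
      have ih' := ih hd.2 (fun M hM => hsub M (List.mem_cons_of_mem N hM))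
      have hT : H1 ∈ filler 𝒞 A H1 N :: (liftAll 𝒞 A H1 v L ++ R1) :=
        List.mem_cons_of_mem _ (List.mem_append_right _ hH1R1)
      have hT' : H1 ∈ liftAll 𝒞 A H1 v L ++ R1 := List.mem_append_right _ hH1R1
      simp only [liftAll, List.cons_append]
      refine ⟨?_, hfill N _ hT', ih'⟩
      -- justify the cylinder
      by_cases hax : ∃ F ∈ 𝒞, N ⊆ F
      · -- split between the axiom flat (cut to A) and H1
        have hF := Classical.choose_spec hax
        refine Justified.split θ (filler 𝒞 A H1 N) H1 List.mem_cons_self hT ?_ ?_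
        · rintro z ⟨hz, hzθ⟩
          unfold filler
          rw [dif_pos hax]
          rcases mem_cyl_iff.1 hz with h | h
          · exact ⟨hF.2 h, (hNH0 h).1⟩
          · exfalso
            have h1 : θ.1 ⬝ᵥ (z + v) = θ.2 := (hNH0 h).2
            rw [dotProduct_add, mem_hyp.1 hzθ, hθv] at h1
            have h2 : ∀ a : ZMod 2, a + 1 ≠ a := by decide
            exact h2 _ h1
        · rintro z ⟨hz, hzθ⟩
          exact ⟨hcylA N hNH0 hz, hzθ⟩
      · -- N was obtained by a split in R0: lift it
        cases hd.1 with
        | ax F hF h => exact absurd ⟨F, hF, h⟩ hax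
        | split η P Q hP hQ hP0 hQ1 =>
          obtain ⟨η', hη'v, hiff⟩ := htwist η
          obtain ⟨hl0, hl1⟩ := hlift_half N hNH0 η η' hη'v hiff
          refine Justified.split η' (cyl v P) (cyl v Q) ?_ ?_ ?_ ?_
          · exact List.mem_cons_of_mem _ (List.mem_append_left _ (cyl_mem_liftAll 𝒞 A H1 v hP))
          · exact List.mem_cons_of_mem _ (List.mem_append_left _ (cyl_mem_liftAll 𝒞 A H1 v hQ))
          · exact hl0.trans (cyl_mono v hP0)
          · exact hl1.trans (cyl_mono v hQ1)
  refine ⟨G, ⟨hderiv R0 hR0.deriv hR0.subset, ?_, ?_, ?_⟩, ?_⟩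
  · -- root: A = cyl v H0
    have hmem : cyl v H0 ∈ G := List.mem_append_left _ (cyl_mem_liftAll 𝒞 A H1 v hR0.root)
    rwa [hcylH0] at hmem
  · -- all lines inside A
    intro X hX
    rw [hG, List.mem_append] at hX
    rcases hX with hX | hX
    · obtain ⟨N, hN, rfl | rfl⟩ := (mem_liftAll_iff 𝒞 A H1 v R0 X).1 hX
      · exact hcylA N (hR0.subset N hN)
      · unfold filler
        split_ifs
        · exact Set.inter_subset_right
        · exact Set.inter_subset_left
    · exact (hR1.subset X hX).trans Set.inter_subset_left
  · -- all lines are flats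
    intro X hX
    rw [hG, List.mem_append] at hX
    rcases hX with hX | hX
    · obtain ⟨N, hN, rfl | rfl⟩ := (mem_liftAll_iff 𝒞 A H1 v R0 X).1 hX
      · exact isFlat_cyl v (hR0.flat N hN)
      · unfold filler
        split_ifs with h
        · exact (hg.flat _ (Classical.choose_spec h).1).inter hA
        · exact hA.inter (isFlat_hyp _)
    · exact hR1.flat X hX
  · -- width
    rw [width_le_iff]
    intro X hX hXne
    rw [hG, List.mem_append] at hX
    rcases hX with hX | hX
    · obtain ⟨N, hN, rfl | rfl⟩ := (mem_liftAll_iff 𝒞 A H1 v R0 X).1 hX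
      · have hNne : N.Nonempty := by
          obtain ⟨z, hz⟩ := hXne
          rcases mem_cyl_iff.1 hz with h | h
          · exact ⟨z, h⟩
          · exact ⟨z + v, h⟩
        rw [hcodim_cyl N (hR0.subset N hN) hNne]
        exact (codim_le_width hN hNne).trans (le_max_of_le_right (le_max_left _ _))
      · revert hXne
        unfold filler
        split_ifs with h
        · intro hXne
          exact (hg.rank _ (Classical.choose_spec h).1 hXne).trans
            (le_max_of_le_right (le_max_right _ _))
        · intro _
          have : codim A H1 = 1 := by unfold codim; omega
          rw [this]
          exact le_max_of_le_left (by omega)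
    · rcases hcodim_H1 X (hR1.subset X hX) with h | h
      · rw [h]
        exact le_max_of_le_left (by simpa using codim_le_width hX hXne)
      · exact absurd (Submodule.finrank_mono (W_anti (hR1.subset X hX))) (not_le.2 h)

end Induction

end ResLinSW

end Summit.PneNP.PneNP.Theorems
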